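import Summits.QuantumFields.BalabanUV.Beta.EriceFlowEnclosureB12AsPrintedHistoryContagionShiftFlowRepinEnd
import Summits.QuantumFields.BalabanUV.Beta.EriceFlowEnclosureB12AsPrintedHistoryContagionShiftFlowRepinScales
import Summits.QuantumFields.BalabanUV.Beta.EriceFlowEnclosureB12AsPrintedPointwiseFadingEventualAFWellPosed

/-!
# Beta / EriceFlowEnclosureB12AsPrintedHistoryContagionShiftFlowRepinMarkov — ASYMPTOTIC FREEDOM IS CONTAGIOUS, part 31: THE MARKOV REDUCTION NEAR ZERO PIN — THE FLOW
# WITH MEMORY HAS AN EFFECTIVE BETA FUNCTION.  Node U2's header quotes Benfatto–Gallavotti (*Renormalization Group*, ch. 10) on the «beta functional» of the whole sequence of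
# running couplings and their question whether the running couplings «can be defined by the dynamical system» of a scale-wise recursion — «one of the outstanding problems of
# the theory» there.  In the abstract setting of this series the answer NEAR ZERO PIN is yes, and it is part 25's cocycle read at one step (§48): given a memory profile and ONE
# asymptotically free reference, EVERY box solution h of `MemFlow B e ·` from EVERY small pin e obeys the ONE-STEP MARKOV LAW **`h(n+1) = R(h(n))`** with the lattice-free
# one-step renormalization map `R g = solution B g 1` (`succ_eq_oneStep`), i.e. **`1∕h(n+1)² = 1∕h(n)² + β_eff(h(n))`** with the EFFECTIVE BETA FUNCTION
# `β_eff(g) = 1∕(solution B g 1)² − 1∕g²` — ONE function of the current coupling, the same for every solution and every scale, although B reads the whole ultraviolet future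
# (`invSq_succ_eq_effBeta`); and β_eff is (⅓)-LIPSCHITZ IN THE CHART 1∕g² (`effBeta_lipschitz`: part 14's two-pin sandwich at the first scale), R strictly increasing there
# (`oneStep_twoSided`).  §49 reads it on the as-printed carrier: from `Theorem2Statement S hL` (a HYPOTHESIS) + `hrg` + NE4 + moduli, below one threshold the CONTINUUM β-VALUES of
# [I] Theorem 2's rows (part 6's `bstar`: `1∕gstar(m′+1)² = 1∕gstar(m′)² + bstar rows m′`) ARE ONE FIXED FUNCTION OF THE RUNNING COUPLING — **`bstar rows m′ = β_eff(gstar rows m′)`**,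
# family- and scale-independent —: (0.20) IN THE CONTINUUM IS A MARKOV RECURSION near zero renormalized coupling (`bstar_eq_effBeta_of_typedTheorem2`), with β_eff (⅓)-Lipschitz in
# the chart (`effBeta_lipschitz_of_typedTheorem2`).  Without the smallness no one-step law exists in general (`exists_no_oneStep_law`: part 29's lag-one witness has two box
# solutions from one running value with different successors).
# Abstract in B (β-flow team, prover 1, unit `b2b-balaban-beta-bflow-p1`, gen 38; ROW AP-I·Uc × NODE U2 — the Markov reduction)

HONEST FRAMING (page 1 of everything the β sub-cell writes): discharging `BetaPertH` makes Bałaban's UV stability UNCONDITIONAL — a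
real constructive-QFT result; it is NOT the continuum limit and NOT the Clay problem.  HONEST DEPENDENCY (cell reorg 2026-08-19,
verbatim): «continuum YM on T⁴ ⇐ BetaPertH ∧ nine spine estimates (0/9 proved); BetaPertH ⇐ (D1) ∧ (D4) ∧ CAP+tail; G-an2-4 gates
asym, D1 and NE2/3/4.»  THIS MODULE DISCHARGES NOTHING: it is BOOKKEEPING BY NAME (part 25's `solution_cocycle_of_reference`, part 13's `memFlow_solution_of_reference ∕
eq_solution_of_memFlow_of_reference`, part 14's `sep_twoSided_of_reference_flow`, part 15's `reference_of_typedTheorem2`, part 6's `continuumCoupling_bigBox_of_typedTheorem2`,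
part 11's `flow_threshold_exists`, node U2's `memoryProfile_betaInf`) over node U2's HYPOTHESIS SHAPES `T4BetaStationary.{SeqBox, MemoryProfile}`, `T4BetaFlowWellPosed.{MemFlow,
solution}`, `T4ContinuumCoupling.{gstar, bstar}` on an ABSTRACT functional `B` and an abstract `S : Setting`; the effective beta function is WRITTEN INLINE
(`1∕(solution B g 1)² − 1∕g²`, no definition introduced).  Benfatto–Gallavotti's ch. 10 (fermionic ∕ φ⁴ trees) is a TEMPLATE only — nothing of it is asserted or used;
`Theorem2Statement S hL` ([I] THEOREM 2 p. 259, STATED WITHOUT PROOF), `hrg` ((0.20) p. 256), NE4 `ScaleShiftRate` (GAPS G-t4-U2-1, p. 298), `HistLipschitz` ∕ `FadingMemory` (GAPS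
G-t4-U2-2) are HYPOTHESES — none asserted for Bałaban's actual β; «continuum running coupling ∕ β-value» = the K → ∞ limits of the effective couplings of (0.20) and of their
increments at fixed physical scale, NOT the continuum limit of the measures.  [I] = T. Bałaban, Commun. Math. Phys. **109** (1987) 249–301 [Balaban1987RG1].

WHAT THIS FILE PROVES (0 sorry, 0 def): §48 **`succ_eq_oneStep`**, **`invSq_succ_eq_effBeta`**, **`oneStep_twoSided`**, **`effBeta_lipschitz`**, **`exists_no_oneStep_law`**
(part 29's witness: no one-step law without the smallness); §49
**`bstar_eq_effBeta_of_typedTheorem2`**, `effBeta_lipschitz_of_typedTheorem2`, **`effBeta_pos_of_typedTheorem2`** (junction with prover 2's gen-46 pointwise floor: the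
effective beta function is ≥ b > 0 near zero).  NOT CLAIMED: Theorem 2; a Markov law AWAY from zero pin or without the reference (false in general —
`exists_no_oneStep_law`, part 29's lag-one witness); anything about Bałaban's β; `BetaPertH`; the continuum limit of the measures; Clay.
-/

namespace Summit.QuantumFields.BalabanUV.Beta.EriceFlowEnclosureB12AsPrintedHistoryContagionShiftFlowRepinMarkov

open Finset Filter Topology
open Literature.MathematicalPhysics.QuantumFieldTheory.Balaban1983to89
open Literature.MathematicalPhysics.QuantumFieldTheory.Balaban1983to89.B12BetaAsPrinted
open Literature.MathematicalPhysics.QuantumFieldTheory.Balaban1983to89.FlowStep (RGEqH)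
open Literature.MathematicalPhysics.QuantumFieldTheory.Balaban1983to89.T4CouplingMatching (HistLipschitz FadingMemory ScaleShiftRate)
open Literature.MathematicalPhysics.QuantumFieldTheory.Balaban1983to89.T4ContinuumCoupling (gstar bstar)
open Literature.MathematicalPhysics.QuantumFieldTheory.Balaban1983to89.T4BetaStationary (SeqBox MemoryProfile betaInf memoryProfile_betaInf)
open Literature.MathematicalPhysics.QuantumFieldTheory.Balaban1983to89.T4BetaFlowWellPosed (MemFlow solution)
open Summit.QuantumFields.BalabanUV.Beta.EriceFlowEnclosureB12AsPrintedHistoryContagionShiftEnd (continuumCoupling_bigBox_of_typedTheorem2)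
open Summit.QuantumFields.BalabanUV.Beta.EriceFlowEnclosureB12AsPrintedHistoryContagionShiftFlowEnd (flow_threshold_exists)
open Summit.QuantumFields.BalabanUV.Beta.EriceFlowEnclosureB12AsPrintedHistoryContagionShiftFlowPicardLimit (memFlow_solution_of_reference
  eq_solution_of_memFlow_of_reference)
open Summit.QuantumFields.BalabanUV.Beta.EriceFlowEnclosureB12AsPrintedHistoryContagionShiftFlowPicardPin (sep_twoSided_of_reference_flow)
open Summit.QuantumFields.BalabanUV.Beta.EriceFlowEnclosureB12AsPrintedHistoryContagionShiftFlowPicardEnd (reference_of_typedTheorem2)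
open Summit.QuantumFields.BalabanUV.Beta.EriceFlowEnclosureB12AsPrintedHistoryContagionShiftFlowRepinTail (solution_cocycle_of_reference)
open Summit.QuantumFields.BalabanUV.Beta.EriceFlowEnclosureB12AsPrintedHistoryContagionShiftFlowRepinScales (memoryProfile_lagOneTent seqBox_slow memFlow_slow
  seqBox_fast memFlow_fast fast_succ)
open Summit.QuantumFields.BalabanUV.Beta.EriceRemainderEnclosureHistoryAutonomyOrder (memFlow_tail)
open Literature.MathematicalPhysics.QuantumFieldTheory.Balaban1983to89.T4BetaFlowWellPosed.Sharpness (tent)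
open Summit.QuantumFields.BalabanUV.Beta.EriceFlowEnclosureB12AsPrintedPointwiseFadingEventualAFWellPosed (betaInf_lower_of_typedTheorem2)
open Summit.QuantumFields.BalabanUV.Beta.EriceFlowEnclosureB12AsPrintedHistoryContagionProfile (le_two_mul_of_profile)

noncomputable section

/-! ## §48 The one-step Markov law of every box solution near zero pin, and the effective beta function -/

/-- **THE ONE-STEP MARKOV LAW.**  `B` with memory profile `(C_m, θ)` on ]0, γ]^ℕ; ONE box solution t of `MemFlow B g* t` with the AF profile `1∕t_a² + β*·m ≤ 1∕t(m)²`; a pin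
`0 < e`, `4e ≤ γ`, with `32C_m e ≤ β*(1 − θ)`, `e²·(1∕g*² + C_mγ∕(1 − θ)² + (2C_m∕((1 − θ)β*))²) ≤ 3∕4`, `4e²·(C_mγ∕(1 − θ)² + (8C_m∕((1 − θ)β*))²) ≤ ½`, `512C_m e³ ≤ (1 − θ)²`; ANY box
solution h of `MemFlow B e h`.  THEN for every n: **`h(n+1) = solution B (h n) 1`** — the next running value is ONE FIXED FUNCTION `R g = solution B g 1` of the current one, the
same for every solution and every scale, although B reads the whole ultraviolet future (h = node U2's `solution B e` by part 13; part 25's cocycle at one step).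
[cite: Balaban1987RG1, Thm 2 (0.31) p.259 with (0.20) p.256 and p.298] -/
theorem succ_eq_oneStep {B : (ℕ → ℝ) → ℝ} {Cm θ γ bs ta gs e : ℝ} {t h : ℕ → ℝ}
    (hB : MemoryProfile Cm θ γ B) (hCm : 0 ≤ Cm) (hθ0 : 0 ≤ θ) (hθ1 : θ < 1) (hbs : 0 < bs) (hta : 0 < ta)
    (hts : SeqBox γ t) (htf : MemFlow B gs t) (hprof : ∀ m : ℕ, 1 / ta ^ 2 + bs * (m : ℝ) ≤ 1 / (t m) ^ 2)
    (he : 0 < e) (h4e : 4 * e ≤ γ)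
    (hs1 : 32 * Cm * e ≤ bs * (1 - θ))
    (hs2 : e ^ 2 * (1 / gs ^ 2 + Cm * γ / (1 - θ) ^ 2 + (2 * Cm / ((1 - θ) * bs)) ^ 2) ≤ 3 / 4)
    (hs2' : 4 * e ^ 2 * (Cm * γ / (1 - θ) ^ 2 + (8 * Cm / ((1 - θ) * bs)) ^ 2) ≤ 1 / 2)
    (hs4 : 512 * Cm * e ^ 3 ≤ (1 - θ) ^ 2) (hhs : SeqBox γ h) (hhf : MemFlow B e h) (n : ℕ) :
    h (n + 1) = solution B (h n) 1 := by
  have h1θ : 0 < 1 - θ := by linarith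
  have h2e : 2 * e ≤ γ := by linarith
  have hs1e : 4 * Cm * e ≤ bs * (1 - θ) := by nlinarith [mul_nonneg hCm he.le]
  have hs4e : 64 * Cm * e ^ 3 ≤ (1 - θ) ^ 2 := by nlinarith [mul_nonneg hCm (pow_nonneg he.le 3)]
  have heq : h = solution B e := eq_solution_of_memFlow_of_reference hB hCm hθ0 hθ1 hbs hta hts htf hprof he h2e hs1e hs2 hs4e hhs hhf
  obtain ⟨hcoc, -⟩ := solution_cocycle_of_reference hB hCm hθ0 hθ1 hbs hta hts htf hprof he h4e hs1 hs2 hs2' hs4 n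
  rw [heq, hcoc 1]

/-- **THE EFFECTIVE BETA FUNCTION.**  Under the data of `succ_eq_oneStep`, for every n: **`1∕h(n+1)² = 1∕h(n)² + β_eff(h(n))`** with `β_eff(g) = 1∕(solution B g 1)² − 1∕g²` —
the flow with memory IS, along its solutions near zero pin, the MARKOV recursion of ONE function of the running coupling (written inline; no definition is introduced).
[cite: Balaban1987RG1, Thm 2 (0.31) p.259 with (0.20) p.256 and p.298] -/
theorem invSq_succ_eq_effBeta {B : (ℕ → ℝ) → ℝ} {Cm θ γ bs ta gs e : ℝ} {t h : ℕ → ℝ}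
    (hB : MemoryProfile Cm θ γ B) (hCm : 0 ≤ Cm) (hθ0 : 0 ≤ θ) (hθ1 : θ < 1) (hbs : 0 < bs) (hta : 0 < ta)
    (hts : SeqBox γ t) (htf : MemFlow B gs t) (hprof : ∀ m : ℕ, 1 / ta ^ 2 + bs * (m : ℝ) ≤ 1 / (t m) ^ 2)
    (he : 0 < e) (h4e : 4 * e ≤ γ)
    (hs1 : 32 * Cm * e ≤ bs * (1 - θ))
    (hs2 : e ^ 2 * (1 / gs ^ 2 + Cm * γ / (1 - θ) ^ 2 + (2 * Cm / ((1 - θ) * bs)) ^ 2) ≤ 3 / 4)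
    (hs2' : 4 * e ^ 2 * (Cm * γ / (1 - θ) ^ 2 + (8 * Cm / ((1 - θ) * bs)) ^ 2) ≤ 1 / 2)
    (hs4 : 512 * Cm * e ^ 3 ≤ (1 - θ) ^ 2) (hhs : SeqBox γ h) (hhf : MemFlow B e h) (n : ℕ) :
    1 / (h (n + 1)) ^ 2 = 1 / (h n) ^ 2 + (1 / (solution B (h n) 1) ^ 2 - 1 / (h n) ^ 2) := by
  rw [succ_eq_oneStep hB hCm hθ0 hθ1 hbs hta hts htf hprof he h4e hs1 hs2 hs2' hs4 hhs hhf n]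
  ring

/-- **THE ONE-STEP MAP IS STRICTLY INCREASING AND BI-LIPSCHITZ IN THE CHART** (part 14 at the first scale): for pins `0 < g ≤ g′` with `2g′ ≤ γ`, `4C_m g′ ≤ β*(1 − θ)`, `g′²Q ≤ 3∕4`,
`64C_m g′³ ≤ (1 − θ)²`, `C_m(8g′³ + 16g′∕β*) ≤ (1 − θ)∕4` (relative to an AF reference of B):
`(2∕3)(1∕g² − 1∕g′²) ≤ 1∕(solution B g 1)² − 1∕(solution B g′ 1)² ≤ (4∕3)(1∕g² − 1∕g′²)`. [cite: Balaban1987RG1, Thm 2 (0.31) p.259 with (0.20) p.256 and p.298] -/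
theorem oneStep_twoSided {B : (ℕ → ℝ) → ℝ} {Cm θ γ bs ta gs g g' : ℝ} {t : ℕ → ℝ}
    (hB : MemoryProfile Cm θ γ B) (hCm : 0 ≤ Cm) (hθ0 : 0 ≤ θ) (hθ1 : θ < 1) (hbs : 0 < bs) (hta : 0 < ta)
    (hts : SeqBox γ t) (htf : MemFlow B gs t) (hprof : ∀ m : ℕ, 1 / ta ^ 2 + bs * (m : ℝ) ≤ 1 / (t m) ^ 2)
    (hg : 0 < g) (hgg' : g ≤ g') (h2g' : 2 * g' ≤ γ)
    (hs1 : 4 * Cm * g' ≤ bs * (1 - θ))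
    (hs2 : g' ^ 2 * (1 / gs ^ 2 + Cm * γ / (1 - θ) ^ 2 + (2 * Cm / ((1 - θ) * bs)) ^ 2) ≤ 3 / 4)
    (hs4 : 64 * Cm * g' ^ 3 ≤ (1 - θ) ^ 2) (hs5 : Cm * (8 * g' ^ 3 + 16 * g' / bs) ≤ (1 - θ) / 4) :
    2 / 3 * (1 / g ^ 2 - 1 / g' ^ 2) ≤ 1 / (solution B g 1) ^ 2 - 1 / (solution B g' 1) ^ 2 ∧
      1 / (solution B g 1) ^ 2 - 1 / (solution B g' 1) ^ 2 ≤ 4 / 3 * (1 / g ^ 2 - 1 / g' ^ 2) := by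
  have h1θ : 0 < 1 - θ := by linarith
  have hg' : 0 < g' := hg.trans_le hgg'
  have h2g : 2 * g ≤ γ := by linarith
  have hQ0 : 0 ≤ 1 / gs ^ 2 + Cm * γ / (1 - θ) ^ 2 + (2 * Cm / ((1 - θ) * bs)) ^ 2 := by
    have hγ : 0 ≤ γ := by linarith
    positivity
  have hs1g : 4 * Cm * g ≤ bs * (1 - θ) := (by nlinarith : 4 * Cm * g ≤ 4 * Cm * g').trans hs1
  have hs2g : g ^ 2 * (1 / gs ^ 2 + Cm * γ / (1 - θ) ^ 2 + (2 * Cm / ((1 - θ) * bs)) ^ 2) ≤ 3 / 4 :=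
    (mul_le_mul_of_nonneg_right (pow_le_pow_left₀ hg.le hgg' 2) hQ0).trans hs2
  have hs4g : 64 * Cm * g ^ 3 ≤ (1 - θ) ^ 2 :=
    (mul_le_mul_of_nonneg_left (pow_le_pow_left₀ hg.le hgg' 3) (by positivity)).trans hs4
  obtain ⟨hss, hsf, -, -⟩ := memFlow_solution_of_reference hB hCm hθ0 hθ1 hbs hta hts htf hprof hg h2g hs1g hs2g hs4g
  obtain ⟨hss', hsf', -, -⟩ := memFlow_solution_of_reference hB hCm hθ0 hθ1 hbs hta hts htf hprof hg' h2g' hs1 hs2 hs4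
  exact sep_twoSided_of_reference_flow hB hCm hθ0 hθ1 hbs hta hts htf hprof hg hgg' h2g' hs1 hs2 hs4 hs5 hss hsf hss' hsf' 1

/-- **THE EFFECTIVE BETA FUNCTION IS (⅓)-LIPSCHITZ IN THE CHART 1∕g²**: under the data of `oneStep_twoSided`,
`|β_eff(g) − β_eff(g′)| ≤ (⅓)·(1∕g² − 1∕g′²)`, `β_eff(x) = 1∕(solution B x 1)² − 1∕x²` — the one-step Markov map of the flow with memory is, near zero pin, a small perturbation of a
constant increment in the chart. [cite: Balaban1987RG1, Thm 2 (0.31) p.259 with (0.20) p.256 and p.298] -/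
theorem effBeta_lipschitz {B : (ℕ → ℝ) → ℝ} {Cm θ γ bs ta gs g g' : ℝ} {t : ℕ → ℝ}
    (hB : MemoryProfile Cm θ γ B) (hCm : 0 ≤ Cm) (hθ0 : 0 ≤ θ) (hθ1 : θ < 1) (hbs : 0 < bs) (hta : 0 < ta)
    (hts : SeqBox γ t) (htf : MemFlow B gs t) (hprof : ∀ m : ℕ, 1 / ta ^ 2 + bs * (m : ℝ) ≤ 1 / (t m) ^ 2)
    (hg : 0 < g) (hgg' : g ≤ g') (h2g' : 2 * g' ≤ γ)
    (hs1 : 4 * Cm * g' ≤ bs * (1 - θ))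
    (hs2 : g' ^ 2 * (1 / gs ^ 2 + Cm * γ / (1 - θ) ^ 2 + (2 * Cm / ((1 - θ) * bs)) ^ 2) ≤ 3 / 4)
    (hs4 : 64 * Cm * g' ^ 3 ≤ (1 - θ) ^ 2) (hs5 : Cm * (8 * g' ^ 3 + 16 * g' / bs) ≤ (1 - θ) / 4) :
    |(1 / (solution B g 1) ^ 2 - 1 / g ^ 2) - (1 / (solution B g' 1) ^ 2 - 1 / g' ^ 2)| ≤ 1 / 3 * (1 / g ^ 2 - 1 / g' ^ 2) := by
  obtain ⟨hlo, hhi⟩ := oneStep_twoSided hB hCm hθ0 hθ1 hbs hta hts htf hprof hg hgg' h2g' hs1 hs2 hs4 hs5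
  rw [abs_le]
  constructor <;> linarith

/-- **NO ONE-STEP LAW WITHOUT THE SMALLNESS — a kernel witness.**  There is a functional with a memory profile `(C_m, θ)` (0 < θ < 1) on a box for which NO function R of the
running coupling satisfies `h(n+1) = R(h(n))` for all box solutions h of its flows: part 29's lag-one tent functional `2 + tent(3u₀ − ½) − tent(3u₁ − ½)` has, from the running value
`6^{−½}`, the two box solutions `(6^{−½}, 8^{−½}, 10^{−½}, …)` (the slow tail) and `(6^{−½}, ⅓, 11^{−½}, …)` with different successors of the same value.  The Markov reduction of
§48 is a NEAR-ZERO-PIN phenomenon. [folklore] -/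
theorem exists_no_oneStep_law :
    ∃ (B : (ℕ → ℝ) → ℝ) (Cm θ γ : ℝ), MemoryProfile Cm θ γ B ∧ 0 ≤ Cm ∧ 0 < θ ∧ θ < 1 ∧
      ¬ ∃ R : ℝ → ℝ, ∀ (e : ℝ) (h : ℕ → ℝ), SeqBox γ h → MemFlow B e h → ∀ n, h (n + 1) = R (h n) := by
  refine ⟨fun u => 2 + tent (3 * u 0 - 1 / 2) - tent (3 * u 1 - 1 / 2), 60 / (1 / 2), 1 / 2, 1 / 2,
    memoryProfile_lagOneTent (by norm_num) (by norm_num), by norm_num, by norm_num, by norm_num, ?_⟩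
  rintro ⟨R, hR⟩
  -- levels are determined by the couplings: `1∕√a = 1∕√b ⟹ a = b` (a, b > 0)
  have key : ∀ a b : ℝ, 0 < a → 0 < b → 1 / Real.sqrt a = 1 / Real.sqrt b → a = b := by
    intro a b ha hb hab
    rw [← T4BetaFlowWellPosed.one_div_sq_one_div_sqrt ha, ← T4BetaFlowWellPosed.one_div_sq_one_div_sqrt hb, hab]
  -- the slow tail from scale 1 and the fast history share the value at 0 and would share the value at 1
  have hslow := hR _ _ (T4BetaFlowWellPosed.seqBox_shift seqBox_slow 1) (memFlow_tail memFlow_slow 1) 0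
  have hfast := hR _ _ seqBox_fast memFlow_fast 0
  have ha : (1 : ℝ) / Real.sqrt (if (0 : ℕ) = 0 then (6 : ℝ) else 7 + 2 * ((0 : ℕ) : ℝ)) = 1 / Real.sqrt (4 + 2 * (((1 + 0 : ℕ)) : ℝ)) := by
    norm_num
  have h1 : (1 : ℝ) / Real.sqrt (if (0 + 1 : ℕ) = 0 then (6 : ℝ) else 7 + 2 * ((0 + 1 : ℕ) : ℝ)) = 1 / Real.sqrt (4 + 2 * (((1 + (0 + 1) : ℕ)) : ℝ)) := by
    rw [hfast, ha]
    exact hslow.symm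
  have hapos : (0 : ℝ) < (if (0 + 1 : ℕ) = 0 then (6 : ℝ) else 7 + 2 * ((0 + 1 : ℕ) : ℝ)) := by
    rw [if_neg (Nat.succ_ne_zero 0)]; positivity
  have e := key _ _ hapos (by positivity) h1
  rw [if_neg (Nat.succ_ne_zero 0)] at e
  push_cast at e
  norm_num at e

/-! ## §49 The carrier: the continuum β-values of Theorem 2's rows are one function of the running coupling -/

variable {S : Setting}

/-- **(0.20) IN THE CONTINUUM IS A MARKOV RECURSION NEAR ZERO — FROM THEOREM 2 AS TYPED.**  `Theorem2Statement S hL` (a HYPOTHESIS), `hrg` on ]0, γ_u], NE4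
`ScaleShiftRate c θ γ_u S.β` (c ≥ 0), `HistLipschitz Λ γ_u S.β` with `FadingMemory C θ Λ` (0 < θ < 1, C ≥ 0; γ_u ARBITRARY) ⟹ for every torus exponent m there is g₁₉ > 0 such that for
EVERY family `rows` of Theorem-2-type rows in ]0, γ_u] pinned at g ≤ g₁₉ and every physical scale m′: (i) **`gstar rows (m′+1) = solution (betaInf S.β) (gstar rows m′) 1`** — the
continuum running coupling one scale further into the ultraviolet is ONE FIXED FUNCTION of the current one; (ii) part 6's continuum β-value is that function's increment:
**`bstar rows m′ = 1∕(solution (betaInf S.β) (gstar rows m′) 1)² − 1∕(gstar rows m′)²`** — ONE effective beta FUNCTION of the running coupling, the same for every row family and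
every scale, although the limit functional `betaInf S.β` reads the whole ultraviolet history.  Benfatto–Gallavotti's question (node U2's header, ch. 10 template) answered in this
abstract setting near zero renormalized coupling. [cite: Balaban1987RG1, Thm 2 (0.31) p.259 with (0.20) p.256 and §5 p.298] -/
theorem bstar_eq_effBeta_of_typedTheorem2 {hL : Odd S.L ∧ 1 < S.L} (h : Theorem2Statement S hL)
    {γu θ C c : ℝ} {Λ : ℕ → ℕ → ℝ} (hγu : 0 < γu)
    (hrg : ∀ P : B12.RunParams, Step.InInterval γu P.K (S.cpl P) → RGEqH P.K S.β (S.cpl P))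
    (hS : ScaleShiftRate c θ γu S.β) (hL' : HistLipschitz Λ γu S.β) (hΛ : FadingMemory C θ Λ)
    (hθ0 : 0 < θ) (hθ1 : θ < 1) (hC : 0 ≤ C) (hc : 0 ≤ c) (m : ℕ) :
    ∃ g₁₉ : ℝ, 0 < g₁₉ ∧ ∀ (g : ℝ) (rows : ℕ → ℕ → ℝ), 0 < g → g ≤ g₁₉ →
      (∀ K, ∃ (m' : ℕ) (g₀ : ℝ), rows K = S.cpl ⟨K, m', g₀⟩) → (∀ K, Step.InInterval γu K (rows K)) → (∀ K, rows K K = g) → ∀ m' : ℕ,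
      gstar rows (m' + 1) = solution (betaInf S.β) (gstar rows m') 1 ∧
      bstar rows m' = 1 / (solution (betaInf S.β) (gstar rows m') 1) ^ 2 - 1 / (gstar rows m') ^ 2 := by
  have h1θ : 0 < 1 - θ := by linarith
  have hB := memoryProfile_betaInf hS hL' hΛ hθ0.le hθ1
  obtain ⟨gr, b, g₂, g₃, t, hgr, hb, hg₂, -, htbox, htflow, hprof, hmem, -⟩ :=
    reference_of_typedTheorem2 h hγu hrg hS hL' hΛ hθ0 hθ1 hC hc m
  obtain ⟨g₂', b₂, b₂', hg₂', -, -, hall⟩ := continuumCoupling_bigBox_of_typedTheorem2 h hγu hrg hS hL' hΛ hθ0 hθ1 hC hc m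
  have h2gr : 0 < 2 * gr := by positivity
  have h8C : 0 ≤ 8 * C := by positivity
  obtain ⟨e₀, he₀, hthr⟩ := flow_threshold_exists (1 / gr ^ 2 + C * γu / (1 - θ) ^ 2 + (2 * C / ((1 - θ) * b)) ^ 2) hC hθ1 hb
  obtain ⟨e₁, he₁, hthr'⟩ := flow_threshold_exists (6 * (C * γu / (1 - θ) ^ 2 + (8 * C / ((1 - θ) * b)) ^ 2)) h8C hθ1 hb
  refine ⟨min e₀ (min e₁ (min (γu / 4) (min g₂ g₂'))), lt_min he₀ (lt_min he₁ (lt_min (by positivity) (lt_min hg₂ hg₂'))),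
    fun g rows hg hle hrow hI hpin m' => ?_⟩
  obtain ⟨-, hs2, -⟩ := hthr g hg (hle.trans (min_le_left _ _))
  obtain ⟨hs1', hs2', hs4'⟩ := hthr' g hg (hle.trans ((min_le_right _ _).trans (min_le_left _ _)))
  have h4g : 4 * g ≤ γu := by linarith [hle.trans ((min_le_right _ _).trans ((min_le_right _ _).trans (min_le_left _ _)))]
  have hle2 : g ≤ g₂ := hle.trans ((min_le_right _ _).trans ((min_le_right _ _).trans ((min_le_right _ _).trans (min_le_left _ _))))
  have hle2' : g ≤ g₂' := hle.trans ((min_le_right _ _).trans ((min_le_right _ _).trans ((min_le_right _ _).trans (min_le_right _ _))))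
  obtain ⟨hbox, hflow⟩ := hmem rows g hrow hI hpin hle2
  obtain ⟨-, -, -, -, hbstar, -⟩ := hall rows g hrow hI hpin hle2'
  have hstep := succ_eq_oneStep hB hC hθ0.le hθ1 hb h2gr htbox htflow hprof hg h4g (by linarith) hs2 (by linarith) (by linarith) hbox hflow m'
  refine ⟨hstep, ?_⟩
  have e := hbstar m'
  rw [hstep] at e
  linarith

/-- **THE EFFECTIVE BETA FUNCTION OF THE LIMIT THEORY IS (⅓)-LIPSCHITZ IN THE CHART — FROM THEOREM 2 AS TYPED.**  Under the data of `bstar_eq_effBeta_of_typedTheorem2`, for every m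
there is g₂₀ > 0 such that for all `0 < g ≤ g′ ≤ g₂₀`: `(2∕3)(1∕g² − 1∕g′²) ≤ 1∕(solution (betaInf S.β) g 1)² − 1∕(solution (betaInf S.β) g′ 1)² ≤ (4∕3)(1∕g² − 1∕g′²)` (the one-step map is
strictly increasing) and `|β_eff(g) − β_eff(g′)| ≤ (⅓)(1∕g² − 1∕g′²)`, `β_eff(x) = 1∕(solution (betaInf S.β) x 1)² − 1∕x²`. [cite: Balaban1987RG1, Thm 2 (0.31) p.259 with (0.20) p.256 and §5 p.298] -/
theorem effBeta_lipschitz_of_typedTheorem2 {hL : Odd S.L ∧ 1 < S.L} (h : Theorem2Statement S hL)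
    {γu θ C c : ℝ} {Λ : ℕ → ℕ → ℝ} (hγu : 0 < γu)
    (hrg : ∀ P : B12.RunParams, Step.InInterval γu P.K (S.cpl P) → RGEqH P.K S.β (S.cpl P))
    (hS : ScaleShiftRate c θ γu S.β) (hL' : HistLipschitz Λ γu S.β) (hΛ : FadingMemory C θ Λ)
    (hθ0 : 0 < θ) (hθ1 : θ < 1) (hC : 0 ≤ C) (hc : 0 ≤ c) (m : ℕ) :
    ∃ g₂₀ : ℝ, 0 < g₂₀ ∧ ∀ g g' : ℝ, 0 < g → g ≤ g' → g' ≤ g₂₀ →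
      (2 / 3 * (1 / g ^ 2 - 1 / g' ^ 2) ≤ 1 / (solution (betaInf S.β) g 1) ^ 2 - 1 / (solution (betaInf S.β) g' 1) ^ 2 ∧
        1 / (solution (betaInf S.β) g 1) ^ 2 - 1 / (solution (betaInf S.β) g' 1) ^ 2 ≤ 4 / 3 * (1 / g ^ 2 - 1 / g' ^ 2)) ∧
      |(1 / (solution (betaInf S.β) g 1) ^ 2 - 1 / g ^ 2) - (1 / (solution (betaInf S.β) g' 1) ^ 2 - 1 / g' ^ 2)| ≤ 1 / 3 * (1 / g ^ 2 - 1 / g' ^ 2) := by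
  have h1θ : 0 < 1 - θ := by linarith
  have hB := memoryProfile_betaInf hS hL' hΛ hθ0.le hθ1
  obtain ⟨gr, b, -, -, t, hgr, hb, -, -, htbox, htflow, hprof, -, -⟩ := reference_of_typedTheorem2 h hγu hrg hS hL' hΛ hθ0 hθ1 hC hc m
  have h2gr : 0 < 2 * gr := by positivity
  obtain ⟨e₀, he₀, hthr⟩ := flow_threshold_exists (1 / gr ^ 2 + C * γu / (1 - θ) ^ 2 + (2 * C / ((1 - θ) * b)) ^ 2) hC hθ1 hb
  -- the kernel smallness `C(8g³ + 16g∕b) ≤ (1−θ)∕4` below e₁ (part 15's construction)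
  set e₁ : ℝ := min 1 ((1 - θ) / (4 * (C * (8 + 16 / b)) + 1)) with he₁
  have he₁0 : 0 < e₁ := lt_min one_pos (by positivity)
  have hs5 : ∀ e : ℝ, 0 < e → e ≤ e₁ → C * (8 * e ^ 3 + 16 * e / b) ≤ (1 - θ) / 4 := by
    intro e he hle
    have hle1 : e ≤ 1 := hle.trans (min_le_left _ _)
    have hle' : e ≤ (1 - θ) / (4 * (C * (8 + 16 / b)) + 1) := hle.trans (min_le_right _ _)
    rw [le_div_iff₀ (by positivity)] at hle'
    have he3 : e ^ 3 ≤ e := by nlinarith [mul_le_mul hle1 hle1 he.le zero_le_one]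
    have hK : 0 ≤ C * (8 + 16 / b) := by positivity
    calc C * (8 * e ^ 3 + 16 * e / b) ≤ C * (8 * e + 16 * e / b) := by gcongr
      _ = e * (C * (8 + 16 / b)) := by ring
      _ ≤ (1 - θ) / 4 := by nlinarith
  refine ⟨min e₀ (min (γu / 2) e₁), lt_min he₀ (lt_min (by positivity) he₁0), fun g g' hg hgg' hle => ?_⟩
  have hg' : 0 < g' := hg.trans_le hgg'
  obtain ⟨hs1, hs2, hs4⟩ := hthr g' hg' (hle.trans (min_le_left _ _))
  have h2g' : 2 * g' ≤ γu := by linarith [hle.trans ((min_le_right _ _).trans (min_le_left _ _))]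
  have hs5' := hs5 g' hg' (hle.trans ((min_le_right _ _).trans (min_le_right _ _)))
  exact ⟨oneStep_twoSided hB hC hθ0.le hθ1 hb h2gr htbox htflow hprof hg hgg' h2g' hs1 hs2 hs4 hs5',
    effBeta_lipschitz hB hC hθ0.le hθ1 hb h2gr htbox htflow hprof hg hgg' h2g' hs1 hs2 hs4 hs5'⟩

/-- **THE EFFECTIVE BETA FUNCTION OF THE LIMIT THEORY IS UNIFORMLY POSITIVE NEAR ZERO — FROM THEOREM 2 AS TYPED** (junction with prover 2's gen-46 pointwise floor
`EriceFlowEnclosureB12AsPrintedPointwiseFadingEventualAFWellPosed.betaInf_lower_of_typedTheorem2`, BY NAME).  `Theorem2Statement S hL` (a HYPOTHESIS), `hrg`, NE4 + moduli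
(0 < θ < 1) ⟹ for every torus exponent m there are b > 0 and g₂₁ > 0 with **`b ≤ 1∕(solution (betaInf S.β) g 1)² − 1∕g²`** for every g ∈ ]0, g₂₁]: the one-step Markov map of the
limit RG equation is ASYMPTOTICALLY FREE near zero renormalized coupling, `1∕R(g)² ≥ 1∕g² + b` (prover 2: `betaInf S.β ≥ b` on a small box ]0, δ]; part 13: node U2's solution from g is
a box solution ≤ 2g; the scale-0 equation of the flow). [cite: Balaban1987RG1, Thm 2 (0.31) p.259 with (0.20) p.256 and §5 p.298] -/
theorem effBeta_pos_of_typedTheorem2 {hL : Odd S.L ∧ 1 < S.L} (h : Theorem2Statement S hL)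
    {γu θ C c : ℝ} {Λ : ℕ → ℕ → ℝ} (hγu : 0 < γu)
    (hrg : ∀ P : B12.RunParams, Step.InInterval γu P.K (S.cpl P) → RGEqH P.K S.β (S.cpl P))
    (hS : ScaleShiftRate c θ γu S.β) (hL' : HistLipschitz Λ γu S.β) (hΛ : FadingMemory C θ Λ)
    (hθ0 : 0 < θ) (hθ1 : θ < 1) (hC : 0 ≤ C) (hc : 0 ≤ c) (m : ℕ) :
    ∃ b g₂₁ : ℝ, 0 < b ∧ 0 < g₂₁ ∧ ∀ g : ℝ, 0 < g → g ≤ g₂₁ → b ≤ 1 / (solution (betaInf S.β) g 1) ^ 2 - 1 / g ^ 2 := by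
  have h1θ : 0 < 1 - θ := by linarith
  have hB := memoryProfile_betaInf hS hL' hΛ hθ0.le hθ1
  obtain ⟨gr, br, -, -, t, hgr, hbr, -, -, htbox, htflow, hprof, -, -⟩ := reference_of_typedTheorem2 h hγu hrg hS hL' hΛ hθ0 hθ1 hC hc m
  have h2gr : 0 < 2 * gr := by positivity
  obtain ⟨e₀, he₀, hthr⟩ := flow_threshold_exists (1 / gr ^ 2 + C * γu / (1 - θ) ^ 2 + (2 * C / ((1 - θ) * br)) ^ 2) hC hθ1 hbr
  -- prover 2's pointwise floor on a small box ]0, δ]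
  obtain ⟨b, hb, k₀, hδex⟩ := betaInf_lower_of_typedTheorem2 h hγu hθ0.le hθ1 hC hrg hL' hΛ hS
  obtain ⟨δ, hδ, -, -, -, -, -, hfloor⟩ := hδex γu hγu
  refine ⟨b, min e₀ (min (γu / 2) (δ / 2)), hb, lt_min he₀ (lt_min (by positivity) (by positivity)), fun g hg hle => ?_⟩
  obtain ⟨hs1, hs2, hs4⟩ := hthr g hg (hle.trans (min_le_left _ _))
  have h2g : 2 * g ≤ γu := by linarith [hle.trans ((min_le_right _ _).trans (min_le_left _ _))]
  have h2gδ : 2 * g ≤ δ := by linarith [hle.trans ((min_le_right _ _).trans (min_le_right _ _))]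
  obtain ⟨hss, hsf, hprofs, -⟩ := memFlow_solution_of_reference hB hC hθ0.le hθ1 hbr h2gr htbox htflow hprof hg h2g hs1 hs2 hs4
  -- the tail of node U2's solution from index 1 is a history in the small box ]0, δ]
  have htail : SeqBox δ (fun j => solution (betaInf S.β) g (0 + 1 + j)) := fun j =>
    ⟨(hss (0 + 1 + j)).1, (le_two_mul_of_profile hbr.le hg (hss (0 + 1 + j)).1 (Nat.cast_nonneg _) (hprofs (0 + 1 + j))).trans h2gδ⟩
  have e0 := hsf.2 0
  rw [hsf.1] at e0
  have hfl := hfloor _ htail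
  rw [show (0 : ℕ) + 1 = 1 from rfl] at e0
  linarith

end

end Summit.QuantumFields.BalabanUV.Beta.EriceFlowEnclosureB12AsPrintedHistoryContagionShiftFlowRepinMarkov
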